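import Literature.Computability.AlgebraicComplexity.LRPencilOfMatrix
import Literature.Computability.AlgebraicComplexity.DetReprEquivalent
import HarnessLib

/-!
# Generalised Grenet matrices (Grenet's branching program with arbitrary arc forms): entries

Topic `Literature/Computability/AlgebraicComplexity`.  Companion of `GrenetEquivariant.lean`
(`Grenet.repr`: Grenet's `(2^N - 1) × (2^N - 1)` matrix of `per_N`, the `(univ, ∅)` minor of
`1 - adj` for the branching program on the subsets of `Fin N`, reindexed along
`e : Finset (Fin N) ≃ Fin 2^N`, times the sign `(-1)^(e univ + e ∅)`) and of `GrenetWeightedPaths.lean`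
(its determinant for arbitrary arc weights); used by `GrenetGradedNormalForm.lean` (the graded
normal form of a pencil with adapted bases, equality case of Landsberg–Ressayre's Thm. 2.8).

A GENERALISED GRENET MATRIX is the same minor for the arc-weighted adjacency matrix `M` in which the
arc `S → insert k S` of the subset lattice carries an arbitrary linear form `∑_c a S k c · x_{k,c}`
in the row-`k` variables instead of Grenet's `x_{k,|S|}` (LR17 §2.2, §6: the graded representations
with Grenet's support).  As in `GrenetWeightedPaths.lean` there are no definitions: `M` enters
through the hypothesis `hM : ∀ S T, M S T = ∑ k, if k ∉ S ∧ T = insert k S then ∑ c, a S k c • X (k, c) else 0`,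
and the rows/columns of the minor are labelled by the subsets `e.symm ((e univ).succAbove i) ≠ univ`
and `e.symm ((e ∅).succAbove j) ≠ ∅`.

* labels: `rowSet_ne_univ`, `colSet_ne_empty`, injectivity, surjectivity onto the subsets
  `≠ univ` / `≠ ∅`;
* entries of `1 - M`: constant part `[S = T]` (`constantCoeff_one_sub_arc`), coefficient of
  `x_{p,q}` supported on the arcs `S → S ∪ {p}` (`coeff_one_sub_arc`), affineness, and the effect
  of rescaling the forms on the arcs leaving `∅` (`one_sub_arc_scale_root`);
* `eq_of_constPart_eq_of_coeffMat_eq` — an affine matrix is determined by `Ã(0)` and the `A_v`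
  (with one-sided versions of the constant-gauge lemmas of `DetReprEquivalent.lean` and
  `LRPencilOfMatrix.lean`).

## References

* B. Grenet, *An upper bound for the permanent versus determinant problem* (2011), Thm. 1
  (key `Grenet2011`).
* J. M. Landsberg, N. Ressayre, *Permanent v. determinant: an exponential lower bound assuming
  symmetry and a potential path towards Valiant's conjecture*, Differential Geom. Appl. 55 (2017)
  146–166, arXiv:1508.05788, §2.2 and §6 (key `LandsbergRessayre2017`).
-/

noncomputable section

open Matrix MvPolynomial Finset

namespace Literature.Computability.AlgebraicComplexity

/-! ### Affine matrices are determined by their constant part and coefficient matrices -/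

section AffineExt

variable {R : Type*} [CommRing R] {σ : Type*} [Fintype σ] {ι : Type*}

/-- Two matrices of affine polynomials with the same constant part `Ã(0)` and the same
coefficient matrices `A_v` are equal (`p = p(0) + ∑_v (∂p/∂x_v) x_v`). [folklore] -/
theorem eq_of_constPart_eq_of_coeffMat_eq {A B : Matrix ι ι (MvPolynomial σ R)}
    (hA : ∀ i j, (A i j).totalDegree ≤ 1) (hB : ∀ i j, (B i j).totalDegree ≤ 1)
    (h0 : constPart A = constPart B) (h1 : ∀ v, LRPencil.coeffMat A v = LRPencil.coeffMat B v) :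
    A = B := by
  refine Matrix.ext fun i j => ?_
  rw [LRPencil.eq_affine_of_totalDegree_le_one (A i j) (hA i j),
    LRPencil.eq_affine_of_totalDegree_le_one (B i j) (hB i j)]
  have e0 : coeff 0 (A i j) = coeff 0 (B i j) := by
    have h := congrFun (congrFun h0 i) j
    simpa only [constPart_apply, constantCoeff_eq] using h
  rw [e0]
  refine congrArg₂ (· + ·) rfl (Finset.sum_congr rfl fun v _ => ?_)
  have e1 := congrFun (congrFun (h1 v) i) j
  simp only [LRPencil.coeffMat_apply] at e1
  rw [e1]

variable [Fintype ι]

omit [Fintype σ] in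
/-- Right multiplication by a constant matrix preserves a bound on the total degree of the
entries. [folklore] -/
theorem totalDegree_mul_map_C_le [DecidableEq ι] {d : ℕ} {M : Matrix ι ι (MvPolynomial σ R)}
    (hM : ∀ i j, (M i j).totalDegree ≤ d) (Q : Matrix ι ι R) (i j : ι) :
    ((M * Q.map C : Matrix ι ι (MvPolynomial σ R)) i j).totalDegree ≤ d := by
  have h := totalDegree_map_C_mul_mul_map_C_le (1 : Matrix ι ι R) Q hM i j
  rwa [Matrix.map_one C C_0 C_1, Matrix.one_mul] at h

omit [Fintype σ] in
/-- Left multiplication by a constant matrix preserves a bound on the total degree of the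
entries. [folklore] -/
theorem totalDegree_map_C_mul_le [DecidableEq ι] {d : ℕ} (P : Matrix ι ι R)
    {M : Matrix ι ι (MvPolynomial σ R)} (hM : ∀ i j, (M i j).totalDegree ≤ d) (i j : ι) :
    ((P.map C * M : Matrix ι ι (MvPolynomial σ R)) i j).totalDegree ≤ d := by
  have h := totalDegree_map_C_mul_mul_map_C_le P (1 : Matrix ι ι R) hM i j
  rwa [Matrix.map_one C C_0 C_1, Matrix.mul_one] at h

omit [Fintype σ] [Fintype ι] in
/-- `constPart` commutes with transposition. [folklore] -/
theorem constPart_transpose (A : Matrix ι ι (MvPolynomial σ R)) : constPart Aᵀ = (constPart A)ᵀ :=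
  Matrix.transpose_map

omit [Fintype σ] [Fintype ι] in
/-- `coeffMat` commutes with transposition. [folklore] -/
theorem coeffMat_transpose (A : Matrix ι ι (MvPolynomial σ R)) (v : σ) :
    LRPencil.coeffMat Aᵀ v = (LRPencil.coeffMat A v)ᵀ :=
  Matrix.transpose_map

omit [Fintype σ] in
/-- `coeffMat (M · Q) v = coeffMat M v · Q` for constant `Q`. [folklore] -/
theorem coeffMat_mul_map_C [DecidableEq ι] (M : Matrix ι ι (MvPolynomial σ R)) (Q : Matrix ι ι R)
    (v : σ) : LRPencil.coeffMat (M * Q.map C) v = LRPencil.coeffMat M v * Q := by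
  have h := LRPencil.coeffMat_C_mul_mul_C (1 : Matrix ι ι R) M Q v
  rwa [Matrix.map_one C C_0 C_1, Matrix.one_mul, Matrix.one_mul] at h

omit [Fintype σ] in
/-- `coeffMat (P · M) v = P · coeffMat M v` for constant `P`. [folklore] -/
theorem coeffMat_map_C_mul [DecidableEq ι] (P : Matrix ι ι R) (M : Matrix ι ι (MvPolynomial σ R))
    (v : σ) : LRPencil.coeffMat (P.map C * M) v = P * LRPencil.coeffMat M v := by
  have h := LRPencil.coeffMat_C_mul_mul_C P M (1 : Matrix ι ι R) v
  rwa [Matrix.map_one C C_0 C_1, Matrix.mul_one, Matrix.mul_one] at h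

end AffineExt

namespace Grenet

variable {K : Type*} [CommRing K] {N m : ℕ}

/-! ### Row and column labels of the `(univ, ∅)` minor -/

section Labels

variable (e : Finset (Fin N) ≃ Fin (m + 1))

/-- The subset labelling the row `i` of the minor is `≠ univ` (the row of `univ` is deleted).
[cite: Grenet2011, Thm. 1] -/
theorem rowSet_ne_univ (i : Fin m) : e.symm ((e univ).succAbove i) ≠ univ :=
  fun h => Fin.succAbove_ne (e univ) i (e.symm.injective (h.trans (e.symm_apply_apply univ).symm))

/-- The subset labelling the column `j` of the minor is `≠ ∅` (the column of `∅` is deleted).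
[cite: Grenet2011, Thm. 1] -/
theorem colSet_ne_empty (j : Fin m) : e.symm ((e ∅).succAbove j) ≠ ∅ :=
  fun h => Fin.succAbove_ne (e ∅) j (e.symm.injective (h.trans (e.symm_apply_apply ∅).symm))

/-- The row labelling is injective. [folklore] -/
theorem rowSet_injective : Function.Injective fun i : Fin m => e.symm ((e univ).succAbove i) :=
  fun _ _ h => Fin.succAbove_right_injective (e.symm.injective h)

/-- The column labelling is injective. [folklore] -/
theorem colSet_injective : Function.Injective fun j : Fin m => e.symm ((e ∅).succAbove j) :=
  fun _ _ h => Fin.succAbove_right_injective (e.symm.injective h)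

/-- Every subset `≠ univ` labels a row. [folklore] -/
theorem exists_rowSet_eq {S : Finset (Fin N)} (hS : S ≠ univ) :
    ∃ i : Fin m, e.symm ((e univ).succAbove i) = S := by
  obtain ⟨z, hz⟩ := Fin.exists_succAbove_eq (show e S ≠ e univ from fun h => hS (e.injective h))
  exact ⟨z, by rw [hz, Equiv.symm_apply_apply]⟩

/-- Every subset `≠ ∅` labels a column. [folklore] -/
theorem exists_colSet_eq {T : Finset (Fin N)} (hT : T ≠ ∅) :
    ∃ j : Fin m, e.symm ((e ∅).succAbove j) = T := by
  obtain ⟨z, hz⟩ := Fin.exists_succAbove_eq (show e T ≠ e ∅ from fun h => hT (e.injective h))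
  exact ⟨z, by rw [hz, Equiv.symm_apply_apply]⟩

end Labels

/-! ### Entries of `1 - M` for the arc forms `∑_c a S k c · x_{k,c}` -/

section Entries

/-- A sign `(-1)^s` is the constant `C ((-1)^s)`. [folklore] -/
theorem neg_one_pow_eq_C (s : ℕ) : (-1 : MvPolynomial (Fin N × Fin N) K) ^ s = C ((-1 : K) ^ s) := by
  rw [map_pow, map_neg, map_one]

variable {a : Finset (Fin N) → Fin N → Fin N → K}
  {M : Matrix (Finset (Fin N)) (Finset (Fin N)) (MvPolynomial (Fin N × Fin N) K)}
  (hM : ∀ S T, M S T = ∑ k : Fin N, if k ∉ S ∧ T = insert k S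
    then ∑ c : Fin N, a S k c • (X (k, c) : MvPolynomial (Fin N × Fin N) K) else 0)
include hM

/-- The constant part of `1 - M` is the identity `[S = T]` (the arc forms have no constant term).
[cite: LandsbergRessayre2017, §2.2] -/
theorem constantCoeff_one_sub_arc (S T : Finset (Fin N)) :
    constantCoeff ((1 - M) S T) = if S = T then 1 else 0 := by
  have h1 : ∀ k : Fin N, constantCoeff (if k ∉ S ∧ T = insert k S
      then ∑ c : Fin N, a S k c • (X (k, c) : MvPolynomial (Fin N × Fin N) K) else 0) = 0 := fun k => by
    split_ifs
    · rw [map_sum]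
      exact sum_eq_zero fun c _ => by rw [constantCoeff_smul, constantCoeff_X, smul_zero]
    · exact map_zero _
  rw [Matrix.sub_apply, map_sub, hM, map_sum, Finset.sum_eq_zero (fun k _ => h1 k), sub_zero,
    Matrix.one_apply]
  split_ifs
  · exact map_one _
  · exact map_zero _

/-- The coefficient of `x_{p,q}` in `1 - M` is supported on the arcs `S → S ∪ {p}`, `p ∉ S`, where
it is `-a S p q`. [cite: LandsbergRessayre2017, §2.2] -/
theorem coeff_one_sub_arc (S T : Finset (Fin N)) (p q : Fin N) :
    coeff (Finsupp.single (p, q) 1) ((1 - M) S T) =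
      -(if p ∉ S ∧ T = insert p S then a S p q else 0) := by
  classical
  have hX : ∀ k c : Fin N, coeff (Finsupp.single (p, q) 1) (X (k, c) : MvPolynomial (Fin N × Fin N) K) =
      if (k, c) = (p, q) then 1 else 0 := fun k c => by
    by_cases h : (k, c) = (p, q)
    · rw [if_pos h, h, coeff_X_same]
    · rw [if_neg h, coeff_X, if_neg fun h' => h ((Finsupp.single_left_inj one_ne_zero).1 h')]
  have h0 : coeff (Finsupp.single (p, q) 1) ((1 : Matrix _ _ (MvPolynomial (Fin N × Fin N) K)) S T) = 0 := by
    rw [Matrix.one_apply]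
    split_ifs
    · rw [coeff_one, if_neg]
      exact fun h => one_ne_zero (Finsupp.single_eq_zero.1 h.symm)
    · exact coeff_zero _
  have h1 : ∀ k : Fin N, coeff (Finsupp.single (p, q) 1) (if k ∉ S ∧ T = insert k S
        then ∑ c : Fin N, a S k c • (X (k, c) : MvPolynomial (Fin N × Fin N) K) else 0) =
      if k ∉ S ∧ T = insert k S then (if k = p then a S k q else 0) else 0 := fun k => by
    split_ifs with hc hk
    · subst hk
      rw [coeff_sum, Finset.sum_eq_single q]
      · rw [coeff_smul, hX, if_pos rfl, smul_eq_mul, mul_one]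
      · intro c _ hc'
        rw [coeff_smul, hX, if_neg (fun h => hc' (Prod.ext_iff.1 h).2), smul_zero]
      · exact fun h => absurd (mem_univ q) h
    · rw [coeff_sum]
      refine sum_eq_zero fun c _ => ?_
      rw [coeff_smul, hX, if_neg (fun h => hk (Prod.ext_iff.1 h).1), smul_zero]
    · exact coeff_zero _
  rw [Matrix.sub_apply, coeff_sub, h0, zero_sub, hM, coeff_sum, Finset.sum_congr rfl (fun k _ => h1 k),
    Finset.sum_eq_single p]
  · simp only [if_true]
  · intro k _ hk
    rw [if_neg hk, ite_self]
  · exact fun h => absurd (mem_univ p) h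

/-- The entries of `1 - M` are affine. [cite: LandsbergRessayre2017, §2.2] -/
theorem totalDegree_one_sub_arc_le (S T : Finset (Fin N)) : ((1 - M) S T).totalDegree ≤ 1 := by
  rw [Matrix.sub_apply, hM]
  refine (totalDegree_sub _ _).trans (max_le ?_ ?_)
  · rw [Matrix.one_apply]
    split_ifs
    · rw [totalDegree_one]; exact Nat.zero_le _
    · rw [totalDegree_zero]; exact Nat.zero_le _
  · refine totalDegree_finsetSum_le fun k _ => ?_
    split_ifs
    · refine totalDegree_finsetSum_le fun c _ => (totalDegree_smul_le _ _).trans ?_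
      exact (isHomogeneous_X K (k, c)).totalDegree_le
    · rw [totalDegree_zero]; exact Nat.zero_le _

/-- The entries of the signed matrix `(-1)^s · (1 - M)` are affine. [cite: LandsbergRessayre2017, §2.2] -/
theorem totalDegree_neg_one_pow_mul_one_sub_arc_le (s : ℕ) (S T : Finset (Fin N)) :
    ((-1 : MvPolynomial (Fin N × Fin N) K) ^ s * (1 - M) S T).totalDegree ≤ 1 := by
  refine (totalDegree_mul _ _).trans ?_
  have h1 : ((-1 : MvPolynomial (Fin N × Fin N) K) ^ s).totalDegree = 0 := by
    refine Nat.eq_zero_of_le_zero ((totalDegree_pow _ _).trans ?_)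
    rw [totalDegree_neg, totalDegree_one, mul_zero]
  rw [h1, zero_add]
  exact totalDegree_one_sub_arc_le hM S T

/-- Rescaling the forms on the arcs leaving `∅` by `t` rescales the row of `∅` of `1 - M` by `t`,
off the column of `∅` (that row has no constant entry there). [folklore] -/
theorem one_sub_arc_scale_root {M' : Matrix (Finset (Fin N)) (Finset (Fin N)) (MvPolynomial (Fin N × Fin N) K)}
    (t : K) (hM' : ∀ S T, M' S T = ∑ k : Fin N, if k ∉ S ∧ T = insert k S
      then ∑ c : Fin N, (if S = ∅ then t * a S k c else a S k c) •
        (X (k, c) : MvPolynomial (Fin N × Fin N) K) else 0)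
    (S T : Finset (Fin N)) (hT : T ≠ ∅) :
    (1 - M') S T = (if S = ∅ then C t else 1) * (1 - M) S T := by
  rw [Matrix.sub_apply, Matrix.sub_apply, hM, hM', Matrix.one_apply]
  by_cases hS : S = ∅
  · subst hS
    rw [if_neg (Ne.symm hT), if_pos rfl, zero_sub, zero_sub, mul_neg, Finset.mul_sum]
    refine congrArg Neg.neg (sum_congr rfl fun k _ => ?_)
    by_cases hk : k ∉ (∅ : Finset (Fin N)) ∧ T = insert k ∅
    · rw [if_pos hk, if_pos hk, Finset.mul_sum]
      exact sum_congr rfl fun c _ => by rw [if_pos rfl, mul_smul, smul_eq_C_mul]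
    · rw [if_neg hk, if_neg hk, mul_zero]
  · rw [if_neg hS, one_mul]
    simp only [hS, if_false]

end Entries

end Grenet

end Literature.Computability.AlgebraicComplexity
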